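import Literature.MathematicalPhysics.QuantumFieldTheory.Balaban1983to89.B9Thm310CommutatorBound389BLocOfInv
import Literature.MathematicalPhysics.QuantumFieldTheory.Balaban1983to89.B9Thm310CommutatorDataOfPlaquettes
import Literature.MathematicalPhysics.QuantumFieldTheory.Balaban1983to89.B9Thm37CommutatorBound389Majorant
import Literature.MathematicalPhysics.QuantumFieldTheory.Balaban1983to89.B9CubeLettersBondOpsL0

/-!
# `Balaban1983to89.B9Thm310CommutatorSum` — T. Bałaban, *Propagators for lattice gauge theories in a background field*, Commun. Math. Phys. **99** (1985)
# 389–434 [Balaban1985BackgroundPropagators], (3.105) p. 414: THE FIRST FAMILY `Σ_□K(h_□)G_□h_□` OF THE REMAINDER `R`, SUMMED OVER THE CUBE COVER OF RECORD —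
# its j-uniform per-cube (3.89) majorants (this seat's `…Bound389BLocOfInv` ∕ `…DataOfPlaquettes`) added up with the overlap count of their localisation sets,
# the count taken from [4] Lemma 2.1 (2.61) itself (sub-row G-B9-LETTERS, module M5.7 FILE 3-B of `lit-balaban-p38/PLAN-M57-g38.md` §3)

statement-level skeleton of published theorems with citation tags; proofs where landed; nothing here is a claim about the Yang–Mills mass gap

PDF held: `paper:balaban1985-cmp99-background-propagators` (journal page = PDF page + 388); pp. 409, 413–416 read from the held text layer.

THE PRINT.  p. 414 (3.105) «Δ_aG₀ = I − Σ_□K(h_□)G_□h_□ − … = I − R», «The operator K(h_□)G_□h_□ satisfies the inequality (3.89), hence it is small. … it will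
follow from this analysis that R satisfies the bound (3.85) with O(M⁻¹) instead of O(α₁)»; p. 409 (3.89) «|(K(h_□)G′_□h_□λ)(x)| ≦ O(M⁻¹)e^{−δ₀(Lʲη)⁻¹|y−y′|}|λ| …
It is exactly the bound (2.44) of [4]»; p. 410 «follows simply from Corollary 3.6 holding for all G′_□, □ ∈ 𝒟, from the bound (3.89) and Lemma 2.1»; [4] =
[Balaban1984PropagatorsII]: p. 232 (2.51)–(2.52) («A summation preserves it also»), Lemma 2.1 (2.61) p. 234, p. 235 (the enlarged cubes; the finite overlap of
the cubes is used silently in every `Σ_{□∈𝒟}`).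

WHY THIS FILE (cell context: G-B9-LETTERS M5.7; FILE 1-B `B9Thm310GTorusRegular.hasMajorant_conj_GAY_of_cubes` takes the TOTAL remainder's majorant `Θ·e^{−δ₀d}`
as one displayed input `hR`; THIS FILE discharges its first family).  Per cube, `…LocOfInv.hasMajorant_conj_KhBY_hTY_of_eBlockInvB_fac_loc` gives `conj b (K(h_□)G_□h_□)`
the majorant `1_{S′_□}(y)·θ₀M⁻¹·e^{−δ₀d(y,y′)}` with ONE `θ₀` for the cubes of every level, on any `S′_□` containing the carrier indices within `2L+4` admissible
bonds of a block met by `supp h_□`; `…DataOfPlaquettes` reads its four holonomy data off one plaquette datum `‖U(∂p) − 1‖ ≤ δ̂(L^{lev p₀})⁻²`.  Summing over `□`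
([4] p. 232; r06's `B9Thm37Sum.hasMajorant_localSum`) needs the OVERLAP COUNT `#{□ : y ∈ S′_□} ≤ N′`.  With `S′_□ := {a : ∃ y ∈ QT □, d_T(βa, y) ≤ 2L+4}`
(`supp h_□ ⊂ QT □`: `blkOf_mem_QT_of_hT_ne_zero`) the count factors as `Σ_{y : d_T(βa,y) ≤ 2L+4} #{□ : y ∈ QT □}`; the second factor is p21∕p38's `3·5^{d+1}`
(`sum_indicator_QT_le`), and the BALL COUNT is taken from (2.61) for the member's own geometry — `d(a,a′) = d_T(βa, βa′)` (`geo9K_dist_eq`), so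
`#{y : d_T(βa, y) ≤ r} ≤ e^{αδ₀r}·Σ_{a′}e^{−αδ₀d(a,a′)} ≤ e^{αδ₀r}c₁(α)` (blocks injected into carrier indices by the section `ιB`): NO new geometry, the
count is a constant `3·5^{d+1}·e^{αδ₀(2L+4)}·c₁(α)` depending on `d, L, α, δ₀` only («constants depending on d and L only», p. 397).

WHAT IS PROVED (all `theorem`s, 0 `def`, 0 sorry).  §1 `sum_indicator_ball_le` (the ball count from (2.61)), ★ `sum_indicator_nearQT_le` (the overlap count
`N′ = 3·5^{d+1}·e^{αδ₀(2L+4)}·c₁(α)` of the sets `S′_□`); §2 ★ `hasMajorant_conj_KhBY_GACubeY_hTY_fac` (per cube: E′₄-loc (C) at the cube letter `G_□(U) = GACubeY`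
with E′₅'s data, on `S′_□`); §3 ★★★ `hasMajorant_sum_conj_KhBY_GACubeY_hTY` (the family summed: majorant `N′·θ₀M⁻¹·e^{−δ₀d}`, `θ₀ = M₂(Σ‖b_j‖)·θ₃₈₉ᴮ(d,L,B₀,b₁,δ₀,1,2δ̂,δ̂(L²+1),δ̂;0)`
— the `Θ₁`-summand of FILE 1-B's `hR` in its literal shape), `hasMajorant_sum_conj_KhBY_GACubeY_hTY_of_reg335P` (the same with the plaquette datum discharged
from print's class (3.35) at the fibre `M_N(ℂ)`, `…DataOfPlaquettes.plaquetteDefect_of_reg335P`).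

HONEST SCOPE.  Displayed: the cube letters' (3.42) blocks over the class `hE` (Cor. 3.6 ∕ Thm 3.3 for `G_□(U)`: M5.1b ∕ M5.2-bond), bi-contractivity of the bond
variables and of the averaging transporters at `U` (`hU`, `hT` — unitary fibre), `η = |c_f|⁻¹`, (2.61) for the member (`h261`, p21's `geo_inputs_geo9K` above its
threshold).  Families 2–4 of `R` are NOT treated here (walk re-expansion of `P`, p. 415; (3.101)).  Nothing continuum ∕ OS ∕ mass gap ∕ Clay; YM mass gap NOT proved
by any of this (Track A conditional rung).  `--supports stmt-QuantumFields-19200`.  Net new unproved facts: 0.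
-/

noncomputable section

namespace Literature.MathematicalPhysics.QuantumFieldTheory.Balaban1983to89.B9Thm310CommutatorSum

open Node00 B9CubeLettersInvReadings
open B9Thm37CubeCoverCommutators (cutMulY hTY)
open B9Thm37CubeCoverCommutatorSizes (side_conditions four_le_P')
open B9Thm37CommutatorBound389Majorant (sum_indicator_QT_le)
open B9Eq3104CutoffCommutators (hBdY KhBY)
open B9Thm310CommutatorBound389B (theta389B theta389B_nonneg b1_pos)
open B9Thm310CommutatorBound389BLocOfInv (hasMajorant_conj_KhBY_hTY_of_eBlockInvB_fac_loc)
open B9Thm310CommutatorDataOfPlaquettes (hP_of_plaquettes hRe_of_bicontractive hKc_of_plaquettes hI_of_plaquettes plaquetteDefect_of_reg335P)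
open B9CubeLettersBondOpsL0 (GACubeY)
open B9Thm37Sum (hasMajorant_localSum)
open B6KLevelCensusIndexV1 (KIdx kGeo)
open B6Ineq2142KLevelV1 (β)
open B6GlobalChartV1 (blkV1)
open B6Geom246MultiLevelBox (bset blkOf)
open B6Geom246MultiLevelTorus (bondT)
open B6Cover236MultiLevelBlocks (cubes)
open B6Partition118KLevelTorusCentral (QT blkOf_mem_QT_of_hT_ne_zero)
open B6RandomWalk (HasMajorant Ineq261 hasMajorant_mono)
open B9Thm34Ext (toB6)
open B9FromB6 (EBlock)
open B9GeoNormsKLevelV1 (geo9K)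
open B9GeoLemma21KLevelV1 (geo9K_dist_eq)
open B9Eq352DivFormLetters (conj)
open Node00.OpsYNablaBridge (chartY)
open scoped Matrix

variable {𝔸 : Type} [NormedRing 𝔸] [NormedAlgebra ℂ 𝔸] [CompleteSpace 𝔸]
variable {d ℓ : ℕ} {hd : 1 ≤ d + 1} {hL : Odd (ℓ + 1) ∧ 1 < ℓ + 1} {b₀ b₁ : ℝ}
variable {ι : Type} [Fintype ι]
variable (i : KIdx d ℓ hd hL b₀ b₁) (b : Module.Basis ι ℝ 𝔸)
variable [Fintype (geo9K i).Site] {Rr : ℝ} {Hp : Prop}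
variable (ιB : BlkY i → IBondY i)

/-! ## §1 The overlap count of the localisation sets `S′_□`, from [4] Lemma 2.1 (2.61) and the `3·5^{d+1}` overlap of the reach sets -/

section Count

/-- **THE BALL COUNT FROM (2.61)**: for a corner-free member (a section `ιB` of `β`) with the row sum (2.61) at exponent `(δ₀, α)`, `αδ₀ ≥ 0`, the number of
torus blocks within `r` admissible bonds of the carrier block `βa` is at most `e^{αδ₀r}·c₁(α)` — `d(a, ιB y) = d_T(βa, y)` (`geo9K_dist_eq`), `1 ≤ e^{αδ₀(r − d)}` on
the ball, and the blocks inject into the carrier indices. [cite: Balaban1984PropagatorsII, Lemma 2.1 (2.61) p.234, (2.45)–(2.46) p.231] -/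
theorem sum_indicator_ball_le (hι : ∀ s, β i.hN i.D i.hk (ιB s) = s) (d' : ℕ) {δ₀ α : ℝ} (hαδ : 0 ≤ α * δ₀)
    (h261 : Ineq261 d' (toB6 (geo9K i) Rr Hp) δ₀ α) (a : IBondY i) (r : ℝ) :
    (∑ y : BlkY i, if (((bondT i.D).dist (β i.hN i.D i.hk a) y : ℕ) : ℝ) ≤ r then (1 : ℝ) else 0) ≤
      Real.exp (α * δ₀ * r) * B6.c1 d' δ₀ α := by
  classical
  have hdist : ∀ y : BlkY i, (geo9K i).dist a (ιB y) = (((bondT i.D).dist (β i.hN i.D i.hk a) y : ℕ) : ℝ) := fun y => by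
    rw [geo9K_dist_eq, hι]
  have h1 : ∀ y : BlkY i, (if (((bondT i.D).dist (β i.hN i.D i.hk a) y : ℕ) : ℝ) ≤ r then (1 : ℝ) else 0) ≤
      Real.exp (α * δ₀ * r) * Real.exp (-(α * δ₀ * (geo9K i).dist a (ιB y))) := by
    intro y
    by_cases h : (((bondT i.D).dist (β i.hN i.D i.hk a) y : ℕ) : ℝ) ≤ r
    · rw [if_pos h, ← Real.exp_add, hdist]
      exact Real.one_le_exp (by nlinarith)
    · rw [if_neg h]
      positivity
  have hinj : Function.Injective ιB := fun y₁ y₂ h => by rw [← hι y₁, ← hι y₂, h]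
  -- the row sum (2.61) at `a`, over the member's carrier indices (the instance of record)
  have hrow : (∑ a' : (geo9K i).Site, Real.exp (-(α * δ₀ * (geo9K i).dist a a'))) ≤ B6.c1 d' δ₀ α := h261 a
  have himg : (∑ y : BlkY i, Real.exp (-(α * δ₀ * (geo9K i).dist a (ιB y)))) =
      ∑ a' ∈ (Finset.univ : Finset (BlkY i)).image (fun y => (ιB y : (geo9K i).Site)), Real.exp (-(α * δ₀ * (geo9K i).dist a a')) := by
    rw [Finset.sum_image fun y₁ _ y₂ _ h => hinj h]
  have hsub : (∑ a' ∈ (Finset.univ : Finset (BlkY i)).image (fun y => (ιB y : (geo9K i).Site)), Real.exp (-(α * δ₀ * (geo9K i).dist a a'))) ≤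
      ∑ a' : (geo9K i).Site, Real.exp (-(α * δ₀ * (geo9K i).dist a a')) :=
    Finset.sum_le_univ_sum_of_nonneg (ι := (geo9K i).Site) fun _ => Real.exp_nonneg _
  calc (∑ y : BlkY i, if (((bondT i.D).dist (β i.hN i.D i.hk a) y : ℕ) : ℝ) ≤ r then (1 : ℝ) else 0)
      ≤ ∑ y : BlkY i, Real.exp (α * δ₀ * r) * Real.exp (-(α * δ₀ * (geo9K i).dist a (ιB y))) := Finset.sum_le_sum fun y _ => h1 y
    _ = Real.exp (α * δ₀ * r) * ∑ y : BlkY i, Real.exp (-(α * δ₀ * (geo9K i).dist a (ιB y))) := by rw [Finset.mul_sum]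
    _ ≤ Real.exp (α * δ₀ * r) * B6.c1 d' δ₀ α := by
        rw [himg]
        exact mul_le_mul_of_nonneg_left (hsub.trans hrow) (Real.exp_nonneg _)

/-- ★ **THE OVERLAP COUNT OF THE LOCALISATION SETS `S′_□ = {a : ∃ y ∈ QT □, d_T(βa, y) ≤ 2L+4}`**: every carrier index lies in at most
`3·5^{d+1}·e^{αδ₀(2L+4)}·c₁(α)` of them — the count factors through the ball of radius `2L+4` around `βa` (`sum_indicator_ball_le`) and the `3·5^{d+1}` overlap
of the reach sets `QT □` (p38∕p21 `sum_indicator_QT_le`). [cite: Balaban1984PropagatorsII, p.235 (finite overlap of the enlarged cubes), Lemma 2.1 (2.61) p.234; Balaban1985BackgroundPropagators, (3.105) p.414 (Σ_□)] -/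
theorem sum_indicator_nearQT_le (hι : ∀ s, β i.hN i.D i.hk (ιB s) = s) (d' : ℕ) {δ₀ α : ℝ} (hαδ : 0 ≤ α * δ₀)
    (h261 : Ineq261 d' (toB6 (geo9K i) Rr Hp) δ₀ α) (a : IBondY i) :
    (∑ c : ↥(cubes i.D.toDomains),
        if (∃ y ∈ QT i.D (B9GeoLemma21KLevelV1.one_le_Mh i) (four_le_P' i) c,
          (((bondT i.D).dist (β i.hN i.D i.hk a) y : ℕ) : ℝ) ≤ 2 * (ℓ : ℝ) + 6) then (1 : ℝ) else 0) ≤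
      3 * 5 ^ (d + 1) * (Real.exp (α * δ₀ * (2 * (ℓ : ℝ) + 6)) * B6.c1 d' δ₀ α) := by
  classical
  -- the ball indicator `Bl y` and the reach indicator are nonnegative
  have hBl0 : ∀ y : BlkY i, (0 : ℝ) ≤ (if (((bondT i.D).dist (β i.hN i.D i.hk a) y : ℕ) : ℝ) ≤ 2 * (ℓ : ℝ) + 6 then (1 : ℝ) else 0) :=
    fun y => ite_nonneg zero_le_one le_rfl
  have hQ0 : ∀ (y : BlkY i) (c : ↥(cubes i.D.toDomains)),
      (0 : ℝ) ≤ (if y ∈ QT i.D (B9GeoLemma21KLevelV1.one_le_Mh i) (four_le_P' i) c then (1 : ℝ) else 0) :=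
    fun y c => ite_nonneg zero_le_one le_rfl
  have hQ : ∀ y : BlkY i, (∑ c : ↥(cubes i.D.toDomains),
      if y ∈ QT i.D (B9GeoLemma21KLevelV1.one_le_Mh i) (four_le_P' i) c then (1 : ℝ) else 0) ≤ 3 * 5 ^ (d + 1) := by
    intro y
    have h := sum_indicator_QT_le i (ιB y)
    rw [hι] at h
    exact h
  have hpt : ∀ c : ↥(cubes i.D.toDomains),
      (if (∃ y ∈ QT i.D (B9GeoLemma21KLevelV1.one_le_Mh i) (four_le_P' i) c,
          (((bondT i.D).dist (β i.hN i.D i.hk a) y : ℕ) : ℝ) ≤ 2 * (ℓ : ℝ) + 6) then (1 : ℝ) else 0) ≤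
        ∑ y : BlkY i, (if (((bondT i.D).dist (β i.hN i.D i.hk a) y : ℕ) : ℝ) ≤ 2 * (ℓ : ℝ) + 6 then (1 : ℝ) else 0) *
          (if y ∈ QT i.D (B9GeoLemma21KLevelV1.one_le_Mh i) (four_le_P' i) c then (1 : ℝ) else 0) := by
    intro c
    by_cases h : ∃ y ∈ QT i.D (B9GeoLemma21KLevelV1.one_le_Mh i) (four_le_P' i) c,
        (((bondT i.D).dist (β i.hN i.D i.hk a) y : ℕ) : ℝ) ≤ 2 * (ℓ : ℝ) + 6
    · rw [if_pos h]
      obtain ⟨y, hyQ, hyd⟩ := h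
      have hy1 : (if (((bondT i.D).dist (β i.hN i.D i.hk a) y : ℕ) : ℝ) ≤ 2 * (ℓ : ℝ) + 6 then (1 : ℝ) else 0) *
          (if y ∈ QT i.D (B9GeoLemma21KLevelV1.one_le_Mh i) (four_le_P' i) c then (1 : ℝ) else 0) = 1 := by
        rw [if_pos hyd, if_pos hyQ, mul_one]
      refine (le_of_eq hy1.symm).trans ?_
      exact Finset.single_le_sum (f := fun y' : BlkY i =>
          (if (((bondT i.D).dist (β i.hN i.D i.hk a) y' : ℕ) : ℝ) ≤ 2 * (ℓ : ℝ) + 6 then (1 : ℝ) else 0) *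
            (if y' ∈ QT i.D (B9GeoLemma21KLevelV1.one_le_Mh i) (four_le_P' i) c then (1 : ℝ) else 0))
        (fun y' _ => mul_nonneg (hBl0 y') (hQ0 y' c)) (Finset.mem_univ y)
    · rw [if_neg h]
      exact Finset.sum_nonneg fun y' _ => mul_nonneg (hBl0 y') (hQ0 y' c)
  calc (∑ c : ↥(cubes i.D.toDomains),
        if (∃ y ∈ QT i.D (B9GeoLemma21KLevelV1.one_le_Mh i) (four_le_P' i) c,
          (((bondT i.D).dist (β i.hN i.D i.hk a) y : ℕ) : ℝ) ≤ 2 * (ℓ : ℝ) + 6) then (1 : ℝ) else 0)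
      ≤ ∑ c : ↥(cubes i.D.toDomains), ∑ y : BlkY i,
          (if (((bondT i.D).dist (β i.hN i.D i.hk a) y : ℕ) : ℝ) ≤ 2 * (ℓ : ℝ) + 6 then (1 : ℝ) else 0) *
            (if y ∈ QT i.D (B9GeoLemma21KLevelV1.one_le_Mh i) (four_le_P' i) c then (1 : ℝ) else 0) :=
        Finset.sum_le_sum fun c _ => hpt c
    _ = ∑ y : BlkY i, (if (((bondT i.D).dist (β i.hN i.D i.hk a) y : ℕ) : ℝ) ≤ 2 * (ℓ : ℝ) + 6 then (1 : ℝ) else 0) *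
          ∑ c : ↥(cubes i.D.toDomains), (if y ∈ QT i.D (B9GeoLemma21KLevelV1.one_le_Mh i) (four_le_P' i) c then (1 : ℝ) else 0) := by
        rw [Finset.sum_comm]
        exact Finset.sum_congr rfl fun y _ => by rw [Finset.mul_sum]
    _ ≤ ∑ y : BlkY i, (if (((bondT i.D).dist (β i.hN i.D i.hk a) y : ℕ) : ℝ) ≤ 2 * (ℓ : ℝ) + 6 then (1 : ℝ) else 0) * (3 * 5 ^ (d + 1)) :=
        Finset.sum_le_sum fun y _ => mul_le_mul_of_nonneg_left (hQ y) (hBl0 y)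
    _ = (∑ y : BlkY i, (if (((bondT i.D).dist (β i.hN i.D i.hk a) y : ℕ) : ℝ) ≤ 2 * (ℓ : ℝ) + 6 then (1 : ℝ) else 0)) * (3 * 5 ^ (d + 1)) := by
        rw [Finset.sum_mul]
    _ ≤ (Real.exp (α * δ₀ * (2 * (ℓ : ℝ) + 6)) * B6.c1 d' δ₀ α) * (3 * 5 ^ (d + 1)) :=
        mul_le_mul_of_nonneg_right (sum_indicator_ball_le i ιB hι d' hαδ h261 a _) (by positivity)
    _ = _ := by ring

end Count

/-! ## §2 The per-cube (3.89) majorant of `K(h_□)G_□(U)h_□` at the cube letter `G_□(U) = GACubeY`, on the localisation set `S′_□` -/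

section Cube

variable {B : B9.Backgrounds} (cfg : B.Cfg → CfgY 𝔸 i) (par : BondParY 𝔸 i) {U₁ : B.Cfg}

/-- ★ **THE FIRST (3.105) FAMILY, ONE CUBE, j-UNIFORM, ON `S′_□`**: for the cube letter `G_□(U) = GACubeY i □ parS parB U` with its (3.42) block over the class at
`U₁` (`hE`), bi-contractive bond variables and averaging transporters, `η = |c_f|⁻¹` and the plaquette datum `‖U(∂p) − 1‖ ≤ δ̂(L^{lev p₀})⁻²`, the real-coordinate
letter `conj b (K(h_□)G_□(U)h_□)` has the majorant `1_{S′_□}(y)·θ₀·M⁻¹·e^{−δ₀d(y,y′)}`, `θ₀ = M₂(Σ‖b_j‖)·θ₃₈₉ᴮ(d,L,B₀,b₁,δ₀,1,2δ̂,δ̂(L²+1),δ̂;0)`, `M = (geo9K i).M`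
— this seat's E′₄-loc (C) with E′₅'s four holonomy data, `S′_□ = {a : ∃ y ∈ QT □, d_T(βa, y) ≤ 2L+4}` ⊇ the required `2L+4`-neighbourhood of the blocks met by
`supp h_□` (`blkOf_mem_QT_of_hT_ne_zero`). [cite: Balaban1985BackgroundPropagators, p.414 («K(h_□)G_□h_□ satisfies the inequality (3.89)»), (3.89) p.409, (3.35) p.396, (3.69) p.404; Balaban1984PropagatorsII, (2.44) p.230, (2.51) p.232] -/
theorem hasMajorant_conj_KhBY_GACubeY_hTY_fac (hι : ∀ s, β i.hN i.D i.hk (ιB s) = s)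
    {M₂ : ℝ} (hM₂ : 0 ≤ M₂) (hrepr : ∀ (v : 𝔸) (j : ι), |b.repr v j| ≤ M₂ * ‖v‖) (hη : etaS i = |i.cf|⁻¹)
    (parS : SiteParY 𝔸 i) (parB : BondParY 𝔸 i) {B₀ δ₀ : ℝ} (hB₀ : 0 ≤ B₀) (hδ₀ : 0 ≤ δ₀)
    (c : ↥(cubes i.D.toDomains)) (hE : EBlock (kernelFamilyBInv i B cfg (GACubeY i c parS parB) par) B₀ δ₀ U₁)
    (hU : ∀ μ x, ‖(cfg U₁ μ x : 𝔸)‖ ≤ 1 ∧ ‖(((cfg U₁ μ x)⁻¹ : 𝔸ˣ) : 𝔸)‖ ≤ 1)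
    (hT : ∀ (y : IBondY i) (f : FBondY i), ‖(qT i parB (cfg U₁) y f : 𝔸)‖ ≤ 1 ∧ ‖(((qT i parB (cfg U₁) y f)⁻¹ : 𝔸ˣ) : 𝔸)‖ ≤ 1)
    {δh : ℝ} (hδh : 0 ≤ δh)
    (hW : ∀ p : PlaqY i, ‖((holY i (cfg U₁) p : 𝔸ˣ) : 𝔸) - 1‖ ≤ δh * ((((ℓ : ℝ) + 1) ^ levY i (chartY i p.src))⁻¹) ^ 2) :
    HasMajorant (g := toB6 (geo9K i) Rr Hp) (fun p : FBondY i × ι => ιB (blkV1 i.hN i.D p.1))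
      (conj b ((KhBY i (hTY i c) parB (cfg U₁) * GACubeY i c parS parB (cfg U₁) * cutMulY (hBdY i (hTY i c))).restrictScalars ℝ))
      (fun a a' => if a ∈ Finset.univ.filter (fun a : IBondY i => ∃ y ∈ QT i.D (B9GeoLemma21KLevelV1.one_le_Mh i) (four_le_P' i) c,
          (((bondT i.D).dist (β i.hN i.D i.hk a) y : ℕ) : ℝ) ≤ 2 * (ℓ : ℝ) + 6)
        then M₂ * (∑ j, ‖b j‖) * theta389B d ℓ B₀ b₁ δ₀ 1 (2 * δh) (δh * (((ℓ : ℝ) + 1) ^ 2 + 1)) δh 0 * ((geo9K i).M)⁻¹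
          * Real.exp (-(δ₀ * (geo9K i).dist a a')) else 0) := by
  classical
  obtain ⟨_, hMh2, hR, _⟩ := side_conditions i
  refine hasMajorant_conj_KhBY_hTY_of_eBlockInvB_fac_loc i b cfg (GACubeY i c parS parB) par (Rr := Rr) (Hp := Hp) hE hM₂ hrepr c parB hB₀ hδ₀ hη ιB hι
    hU hT (by positivity) zero_le_one (by positivity) hδh
    (hP_of_plaquettes i (cfg U₁) hU hδh hW) (hRe_of_bicontractive i (cfg U₁) hU) (hKc_of_plaquettes i (cfg U₁) hU hδh hW) (hI_of_plaquettes i (cfg U₁) hU hW)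
    _ (fun Λ => rfl) _ fun a ha => ?_
  obtain ⟨u, hu, hdu⟩ := ha
  exact Finset.mem_filter.2 ⟨Finset.mem_univ _, blkOf i.D.toDomains u, blkOf_mem_QT_of_hT_ne_zero hMh2 hR (four_le_P' i) c hu, hdu⟩

end Cube

/-! ## §3 The family summed over the cover: the `Θ₁`-summand of FILE 1-B's total-remainder majorant -/

section Sum

variable {B : B9.Backgrounds} (cfg : B.Cfg → CfgY 𝔸 i) (par : BondParY 𝔸 i) {U₁ : B.Cfg}

/-- ★★★ **`Σ_□K(h_□)G_□(U)h_□` HAS THE MAJORANT `N′·θ₀M⁻¹·e^{−δ₀d}`, `N′ = 3·5^{d+1}·e^{αδ₀(2L+4)}·c₁(α)`** — the first family of the remainder `R` of (3.105) summed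
over the cube cover of record in real coordinates ([4] p. 232 «A summation preserves it also»; r06's `hasMajorant_localSum` with the localisation weights
`1_{S′_□}` of overlap `N′`, `sum_indicator_nearQT_le`): `θ₀ = M₂(Σ‖b_j‖)·θ₃₈₉ᴮ(d,L,B₀,b₁,δ₀,1,2δ̂,δ̂(L²+1),δ̂;0)` is ONE constant for the cubes of every level, so the
family's size is `O(M⁻¹)` uniformly in `k` — print's «R satisfies the bound (3.85) with O(M⁻¹) instead of O(α₁)» for this family.  Inputs displayed: the cube
letters' (3.42) blocks `hE`, bi-contractivity `hU`∕`hT`, `η = |c_f|⁻¹`, the plaquette datum `hW`, (2.61) `h261` with `αδ₀ ≥ 0`.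
[cite: Balaban1985BackgroundPropagators, (3.105) p.414, (3.89) p.409, p.410; Balaban1984PropagatorsII, (2.51)–(2.52) p.232, Lemma 2.1 (2.61) p.234, p.235] -/
theorem hasMajorant_sum_conj_KhBY_GACubeY_hTY (hι : ∀ s, β i.hN i.D i.hk (ιB s) = s)
    {M₂ : ℝ} (hM₂ : 0 ≤ M₂) (hrepr : ∀ (v : 𝔸) (j : ι), |b.repr v j| ≤ M₂ * ‖v‖) (hη : etaS i = |i.cf|⁻¹)
    (parS : SiteParY 𝔸 i) (parB : BondParY 𝔸 i) {B₀ δ₀ : ℝ} (hB₀ : 0 ≤ B₀) (hδ₀ : 0 ≤ δ₀)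
    (hE : ∀ c : ↥(cubes i.D.toDomains), EBlock (kernelFamilyBInv i B cfg (GACubeY i c parS parB) par) B₀ δ₀ U₁)
    (hU : ∀ μ x, ‖(cfg U₁ μ x : 𝔸)‖ ≤ 1 ∧ ‖(((cfg U₁ μ x)⁻¹ : 𝔸ˣ) : 𝔸)‖ ≤ 1)
    (hT : ∀ (y : IBondY i) (f : FBondY i), ‖(qT i parB (cfg U₁) y f : 𝔸)‖ ≤ 1 ∧ ‖(((qT i parB (cfg U₁) y f)⁻¹ : 𝔸ˣ) : 𝔸)‖ ≤ 1)
    {δh : ℝ} (hδh : 0 ≤ δh)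
    (hW : ∀ p : PlaqY i, ‖((holY i (cfg U₁) p : 𝔸ˣ) : 𝔸) - 1‖ ≤ δh * ((((ℓ : ℝ) + 1) ^ levY i (chartY i p.src))⁻¹) ^ 2)
    (d' : ℕ) {α : ℝ} (hαδ : 0 ≤ α * δ₀) (h261 : Ineq261 d' (toB6 (geo9K i) Rr Hp) δ₀ α) :
    HasMajorant (g := toB6 (geo9K i) Rr Hp) (fun p : FBondY i × ι => ιB (blkV1 i.hN i.D p.1))
      (∑ c : ↥(cubes i.D.toDomains),
        conj b ((KhBY i (hTY i c) parB (cfg U₁) * GACubeY i c parS parB (cfg U₁) * cutMulY (hBdY i (hTY i c))).restrictScalars ℝ))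
      (fun a a' => (3 * 5 ^ (d + 1) * (Real.exp (α * δ₀ * (2 * (ℓ : ℝ) + 6)) * B6.c1 d' δ₀ α)) *
          (M₂ * (∑ j, ‖b j‖) * theta389B d ℓ B₀ b₁ δ₀ 1 (2 * δh) (δh * (((ℓ : ℝ) + 1) ^ 2 + 1)) δh 0 * ((geo9K i).M)⁻¹) *
        Real.exp (-(δ₀ * (geo9K i).dist a a'))) := by
  classical
  have hSb : 0 ≤ ∑ j, ‖b j‖ := Finset.sum_nonneg fun _ _ => norm_nonneg _
  have hθ0 : ∀ a : IBondY i, 0 ≤ (M₂ * (∑ j, ‖b j‖) * theta389B d ℓ B₀ b₁ δ₀ 1 (2 * δh) (δh * (((ℓ : ℝ) + 1) ^ 2 + 1)) δh 0 * ((geo9K i).M)⁻¹) := fun a => mul_nonneg (mul_nonneg (mul_nonneg hM₂ hSb)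
    (theta389B_nonneg d ℓ hB₀ (b1_pos i a).le zero_le_one (by positivity) (by positivity) hδh δ₀ 0))
    (inv_nonneg.2 (B9GeoLemma21KLevelV1.geo9K_M_nonneg i))
  -- [4] p. 232 «A summation preserves it also»: the per-cube majorants of §2 add up
  have hsum := B9Thm37Sum.hasMajorant_finsetSum (G := toB6 (geo9K i) Rr Hp) (fun p : FBondY i × ι => ιB (blkV1 i.hN i.D p.1))
    (Finset.univ : Finset ↥(cubes i.D.toDomains)) _ _
    fun c _ => hasMajorant_conj_KhBY_GACubeY_hTY_fac i b ιB cfg par (Rr := Rr) (Hp := Hp) hι hM₂ hrepr hη parS parB hB₀ hδ₀ c (hE c) hU hT hδh hW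
  refine hasMajorant_mono (g := toB6 (geo9K i) Rr Hp) _ hsum fun a a' => ?_
  -- the localisation weights factor out; their sum is the overlap count of §1
  have hE0 : 0 ≤ (M₂ * (∑ j, ‖b j‖) * theta389B d ℓ B₀ b₁ δ₀ 1 (2 * δh) (δh * (((ℓ : ℝ) + 1) ^ 2 + 1)) δh 0 * ((geo9K i).M)⁻¹) * Real.exp (-(δ₀ * (geo9K i).dist a a')) := mul_nonneg (hθ0 a) (Real.exp_nonneg _)
  have hterm : ∀ c : ↥(cubes i.D.toDomains),
      (if a ∈ Finset.univ.filter (fun a : IBondY i => ∃ y ∈ QT i.D (B9GeoLemma21KLevelV1.one_le_Mh i) (four_le_P' i) c,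
          (((bondT i.D).dist (β i.hN i.D i.hk a) y : ℕ) : ℝ) ≤ 2 * (ℓ : ℝ) + 6)
        then (M₂ * (∑ j, ‖b j‖) * theta389B d ℓ B₀ b₁ δ₀ 1 (2 * δh) (δh * (((ℓ : ℝ) + 1) ^ 2 + 1)) δh 0 * ((geo9K i).M)⁻¹) * Real.exp (-(δ₀ * (geo9K i).dist a a')) else 0) =
      (if (∃ y ∈ QT i.D (B9GeoLemma21KLevelV1.one_le_Mh i) (four_le_P' i) c,
          (((bondT i.D).dist (β i.hN i.D i.hk a) y : ℕ) : ℝ) ≤ 2 * (ℓ : ℝ) + 6) then (1 : ℝ) else 0) *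
        ((M₂ * (∑ j, ‖b j‖) * theta389B d ℓ B₀ b₁ δ₀ 1 (2 * δh) (δh * (((ℓ : ℝ) + 1) ^ 2 + 1)) δh 0 * ((geo9K i).M)⁻¹) * Real.exp (-(δ₀ * (geo9K i).dist a a'))) := by
    intro c
    by_cases h : ∃ y ∈ QT i.D (B9GeoLemma21KLevelV1.one_le_Mh i) (four_le_P' i) c,
        (((bondT i.D).dist (β i.hN i.D i.hk a) y : ℕ) : ℝ) ≤ 2 * (ℓ : ℝ) + 6
    · have hm : a ∈ Finset.univ.filter (fun a : IBondY i => ∃ y ∈ QT i.D (B9GeoLemma21KLevelV1.one_le_Mh i) (four_le_P' i) c,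
          (((bondT i.D).dist (β i.hN i.D i.hk a) y : ℕ) : ℝ) ≤ 2 * (ℓ : ℝ) + 6) := Finset.mem_filter.2 ⟨Finset.mem_univ (α := IBondY i) a, h⟩
      rw [if_pos hm, if_pos h, one_mul]
    · have hm : a ∉ Finset.univ.filter (fun a : IBondY i => ∃ y ∈ QT i.D (B9GeoLemma21KLevelV1.one_le_Mh i) (four_le_P' i) c,
          (((bondT i.D).dist (β i.hN i.D i.hk a) y : ℕ) : ℝ) ≤ 2 * (ℓ : ℝ) + 6) := fun hm => h (Finset.mem_filter.1 hm).2
      rw [if_neg hm, if_neg h, zero_mul]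
  rw [Finset.sum_congr rfl fun c _ => hterm c, ← Finset.sum_mul]
  calc (∑ c : ↥(cubes i.D.toDomains), if (∃ y ∈ QT i.D (B9GeoLemma21KLevelV1.one_le_Mh i) (four_le_P' i) c,
          (((bondT i.D).dist (β i.hN i.D i.hk a) y : ℕ) : ℝ) ≤ 2 * (ℓ : ℝ) + 6) then (1 : ℝ) else 0) *
        ((M₂ * (∑ j, ‖b j‖) * theta389B d ℓ B₀ b₁ δ₀ 1 (2 * δh) (δh * (((ℓ : ℝ) + 1) ^ 2 + 1)) δh 0 * ((geo9K i).M)⁻¹) * Real.exp (-(δ₀ * (geo9K i).dist a a')))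
      ≤ (3 * 5 ^ (d + 1) * (Real.exp (α * δ₀ * (2 * (ℓ : ℝ) + 6)) * B6.c1 d' δ₀ α)) *
        ((M₂ * (∑ j, ‖b j‖) * theta389B d ℓ B₀ b₁ δ₀ 1 (2 * δh) (δh * (((ℓ : ℝ) + 1) ^ 2 + 1)) δh 0 * ((geo9K i).M)⁻¹) * Real.exp (-(δ₀ * (geo9K i).dist a a'))) :=
        mul_le_mul_of_nonneg_right (sum_indicator_nearQT_le i ιB hι d' hαδ h261 a) hE0
    _ = _ := by ring

end Sum

/-! ## §4 The same with the plaquette datum read off print's class (3.35) at the fibre `M_N(ℂ)` -/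

section Reg335

open scoped Matrix.Norms.L2Operator
open B9BackgroundsKLevelV1 B9BackgroundsKLevelV1P

variable {N : ℕ}

/-- **THE FIRST FAMILY SUMMED, ON THE CLASS (3.35)** (`M_N(ℂ)`, def-Y's `bg9KP`, `c ≤ 10`, `Mα₀ ≥ 0`): §3 with `δ̂ := 2K(1+K)e^{4K}·L²`, `K = 10L·(Mα₀)`, the plaquette datum
of `…DataOfPlaquettes.plaquetteDefect_of_reg335P` — so the family's `θ₀` depends on `d, L, B₀, b₁, δ₀, M₂Σ‖b_j‖` and `Mα₀` only (print: (3.35) bounds `|A|, |∇A|` on `□`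
by `O(1)Mα₀(Lʲη)^{−1,−2}`; the (3.89) size is uniform in `j`). Bi-contractivity of the variables ∕ transporters stays displayed (unitary fibre).
[cite: Balaban1985BackgroundPropagators, (3.35) p.396, (3.69) p.404, (3.105) p.414, (3.89) p.409; Balaban1984PropagatorsII, Lemma 2.1 (2.61) p.234] -/
theorem hasMajorant_sum_conj_KhBY_GACubeY_hTY_of_reg335P [Nonempty (Fin N)] {ι : Type} [Fintype ι]
    (i : KIdx d ℓ hd hL b₀ b₁) (b : Module.Basis ι ℝ (Matrix (Fin N) (Fin N) ℂ)) [Fintype (geo9K i).Site]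
    {Rr : ℝ} {Hp : Prop} (ιB : BlkY i → IBondY i) (hι : ∀ s, β i.hN i.D i.hk (ιB s) = s)
    {B : B9.Backgrounds} (cfg : B.Cfg → CfgY (Matrix (Fin N) (Fin N) ℂ) i) (par : BondParY (Matrix (Fin N) (Fin N) ℂ) i) {U₁ : B.Cfg}
    {M₂ : ℝ} (hM₂ : 0 ≤ M₂) (hrepr : ∀ (v : Matrix (Fin N) (Fin N) ℂ) (j : ι), |b.repr v j| ≤ M₂ * ‖v‖) (hη : etaS i = |i.cf|⁻¹)
    (parS : SiteParY (Matrix (Fin N) (Fin N) ℂ) i) (parB : BondParY (Matrix (Fin N) (Fin N) ℂ) i) {B₀ δ₀ : ℝ} (hB₀ : 0 ≤ B₀) (hδ₀ : 0 ≤ δ₀)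
    (hE : ∀ c : ↥(cubes i.D.toDomains), EBlock (kernelFamilyBInv i B cfg (GACubeY i c parS parB) par) B₀ δ₀ U₁)
    (hU : ∀ μ x, ‖(cfg U₁ μ x : Matrix (Fin N) (Fin N) ℂ)‖ ≤ 1 ∧ ‖(((cfg U₁ μ x)⁻¹ : (Matrix (Fin N) (Fin N) ℂ)ˣ) : Matrix (Fin N) (Fin N) ℂ)‖ ≤ 1)
    (hT : ∀ (y : IBondY i) (f : FBondY i), ‖(qT i parB (cfg U₁) y f : Matrix (Fin N) (Fin N) ℂ)‖ ≤ 1 ∧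
      ‖(((qT i parB (cfg U₁) y f)⁻¹ : (Matrix (Fin N) (Fin N) ℂ)ˣ) : Matrix (Fin N) (Fin N) ℂ)‖ ≤ 1)
    {G : Subgroup (Matrix (Fin N) (Fin N) ℂ)ˣ} {c₀ α₀ : ℝ} (hc : c₀ ≤ 10) (hMα : 0 ≤ (kGeo i).M * α₀)
    (h335 : (bg9KP (Matrix (Fin N) (Fin N) ℂ) G i).Reg335 c₀ α₀ (cfg U₁))
    (d' : ℕ) {α : ℝ} (hαδ : 0 ≤ α * δ₀) (h261 : Ineq261 d' (toB6 (geo9K i) Rr Hp) δ₀ α) :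
    HasMajorant (g := toB6 (geo9K i) Rr Hp) (fun p : FBondY i × ι => ιB (blkV1 i.hN i.D p.1))
      (∑ c : ↥(cubes i.D.toDomains),
        conj b ((KhBY i (hTY i c) parB (cfg U₁) * GACubeY i c parS parB (cfg U₁) * cutMulY (hBdY i (hTY i c))).restrictScalars ℝ))
      (fun a a' => (3 * 5 ^ (d + 1) * (Real.exp (α * δ₀ * (2 * (ℓ : ℝ) + 6)) * B6.c1 d' δ₀ α)) *
          (M₂ * (∑ j, ‖b j‖) *
            theta389B d ℓ B₀ b₁ δ₀ 1
              (2 * ((2 * (10 * (kGeo i).L * ((kGeo i).M * α₀)) * (1 + 10 * (kGeo i).L * ((kGeo i).M * α₀)) *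
                Real.exp (4 * (10 * (kGeo i).L * ((kGeo i).M * α₀))) * ((ℓ : ℝ) + 1) ^ 2)))
              (((2 * (10 * (kGeo i).L * ((kGeo i).M * α₀)) * (1 + 10 * (kGeo i).L * ((kGeo i).M * α₀)) *
                Real.exp (4 * (10 * (kGeo i).L * ((kGeo i).M * α₀))) * ((ℓ : ℝ) + 1) ^ 2)) * (((ℓ : ℝ) + 1) ^ 2 + 1))
              ((2 * (10 * (kGeo i).L * ((kGeo i).M * α₀)) * (1 + 10 * (kGeo i).L * ((kGeo i).M * α₀)) *
                Real.exp (4 * (10 * (kGeo i).L * ((kGeo i).M * α₀))) * ((ℓ : ℝ) + 1) ^ 2)) 0 * ((geo9K i).M)⁻¹) *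
        Real.exp (-(δ₀ * (geo9K i).dist a a'))) := by
  have hL0 : 0 ≤ (kGeo i).L := zero_le_one.trans (B9Eq335PlaquetteAtLettersY.one_le_L i)
  have hK : 0 ≤ 10 * (kGeo i).L * ((kGeo i).M * α₀) := mul_nonneg (mul_nonneg (by norm_num) hL0) hMα
  have hδh : 0 ≤ (2 * (10 * (kGeo i).L * ((kGeo i).M * α₀)) * (1 + 10 * (kGeo i).L * ((kGeo i).M * α₀)) *
      Real.exp (4 * (10 * (kGeo i).L * ((kGeo i).M * α₀))) * ((ℓ : ℝ) + 1) ^ 2) := by positivity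
  exact hasMajorant_sum_conj_KhBY_GACubeY_hTY i b ιB cfg par hι hM₂ hrepr hη parS parB hB₀ hδ₀ hE hU hT hδh
    (fun p => plaquetteDefect_of_reg335P i (cfg U₁) hc hMα h335 p) d' hαδ h261

end Reg335

end Literature.MathematicalPhysics.QuantumFieldTheory.Balaban1983to89.B9Thm310CommutatorSum

end
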